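import Summits.QuantumAdvantage.QuantumAdvantage.Theorems.EchoDialA

/-! # EchoDialB — part 2/5 of the landing twins of NODE «EchoDial» (decomp-qadv lens-2; node file
`g22/EchoDial.lean`, sha256 2019ca7807e3a40c…; generator `g23/tree/gen_twins.py`: namespace
`Theses.EchoDial` → `Theorems.EchoDial`, cut at declaration boundaries, docstrings added where missing, nothing else).
Content: §2 THE ECHO LAW (`EchoDeg`, `echo_orbit_loses`, `echo_loss_count`, `echo_loss_count_all`) and §3 rungs 0 and 1 by
name (`echoDeg_zero_of_frozen`, `echoDeg_one_of_addResp`). -/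

set_option linter.dupNamespace false
noncomputable section
open scoped Classical

namespace Summit.QuantumAdvantage.QuantumAdvantage.Theorems.EchoDial
open Finset
open Literature.Computability.QuantumComplexity Literature.Computability.QuantumComplexity.RingHLF
open Literature.Computability.MetaComplexity Literature.Computability.MetaComplexity.Smolensky
open Summit.QuantumAdvantage.AdviceFreeQNC0 hiding sgn3
open Summit.QuantumAdvantage.QuantumAdvantage.Theorems.AnchorDial (outB dev cN orbF cN_orbF_cast oddZeros_orbF
  orbF_apply_of_far card_filter_orbF orbF_false win_iff gCond_iff_cN three_counts card_odd_ge loss_shape_mono)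
open Summit.QuantumAdvantage.QuantumAdvantage.Theorems.AnchorDial.Core (ct sg)
open Summit.QuantumAdvantage.QuantumAdvantage.Theorems.HolonomyDial (gCond card_odd_le)
open Summit.QuantumAdvantage.QuantumAdvantage.Theorems.StabilizerDial (pad pad_mem rel_pad_iff StabFew apStrat apStrat_mem)
open Summit.QuantumAdvantage.QuantumAdvantage.Theorems.SparsityDial (stabFew_mono_mr one_le_logpow)
open Summit.QuantumAdvantage.QuantumAdvantage.Theorems.ResponseDial (lodd lodd_mem lodd_eq_sum qpoly qpoly_mem qbit qpoly_apply
  hcStrat mem_dev_hcStrat_iff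
  sgn3 sgn3_ne dev_pad_zero not_polylogSparse_of_agree orbF_apply mod3_ne_two castZ2_of_mod_eq_zero
  castZ2_of_mod_eq_one εOf sF lam CertOK certOK_lam AddResp)
open Summit.QuantumAdvantage.QuantumAdvantage.Theses.SparsityDial (DenseGenericLoss3)
open Summit.QuantumAdvantage.QuantumAdvantage.Theorems.CounterDial (StabCounter CounterLoss3 NonCounterGenericLoss3 lin CounterForm
  xloc xloc_castLE oddZeros_xloc lin_xloc bsel mem_iff_bsel card_false_five)
open Summit.QuantumAdvantage.QuantumAdvantage.Theorems.HolonomyDial (tPoly tPoly_mem tPoly_apply xorP xorP_mem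
  xorP_apply_bool mono_singleton_apply)

/-! ## §2  THE ECHO LAW — every strategy whose deviation field ECHOES with `𝔽₂`-degree `≤ d` along an `F`-site orbit
loses somewhere on the orbit, whenever `CertFamily d F`; no degree, density, window or gauge hypothesis. -/

section Law
variable {N F : ℕ}

/-- admissible placements of `F` adjacent pair-flip sites: pairwise separated, inside `[0, N − 3]`. -/
def SitesF (N F : ℕ) (b : Fin F → ℕ) : Prop := (∀ i j : Fin F, i < j → b i + 2 ≤ b j) ∧ ∀ i, b i + 3 ≤ N

/-- the GROUP of position `k`: how many flip sites it has passed. -/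
def grp (b : Fin F → ℕ) (k : ℕ) : ℕ := (univ.filter fun i : Fin F => b i + 1 ≤ k).card

/-- the passed sites form an initial segment: `[b_i + 1 ≤ k] = [i < grp b k]` (generic-`F` `ResponseDial.side_eq`). -/
theorem side_eqF {b : Fin F → ℕ} (hb : ∀ i j : Fin F, i < j → b i + 2 ≤ b j) (k : ℕ) (i : Fin F) :
    decide (b i + 1 ≤ k) = decide (i.val < grp b k) := by
  unfold grp
  by_cases h : b i + 1 ≤ k
  · have hsub : Finset.Iic i ⊆ univ.filter fun i : Fin F => b i + 1 ≤ k := by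
      intro j hj
      rw [Finset.mem_Iic] at hj
      rw [mem_filter]
      refine ⟨mem_univ _, ?_⟩
      rcases lt_or_eq_of_le hj with hlt | heq
      · have := hb j i hlt; omega
      · rw [heq]; exact h
    have hc := card_le_card hsub
    rw [Fin.card_Iic] at hc
    rw [decide_eq_true h, decide_eq_true (by omega)]
  · have hsub : (univ.filter fun i : Fin F => b i + 1 ≤ k) ⊆ Finset.Iio i := by
      intro j hj
      rw [mem_filter] at hj
      rw [Finset.mem_Iio]
      by_contra hle
      push Not at hle
      rcases lt_or_eq_of_le hle with hlt | heq
      · have := hb i j hlt; omega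
      · rw [heq] at h; exact h hj.2
    have hc := card_le_card hsub
    rw [Fin.card_Iio] at hc
    rw [decide_eq_false h, decide_eq_false (by omega)]

/-- the orbit phase shift at position `k` is the phase form at its group. -/
theorem shift_eqF {b : Fin F → ℕ} (hb : ∀ i j : Fin F, i < j → b i + 2 ≤ b j) (z ε : Fin F → Bool) (k : ℕ) :
    ∑ i : Fin F, ct (ε i) (xor (z i) (decide (b i + 1 ≤ k))) = phase z ε (grp b k) := by
  unfold phase
  exact sum_congr rfl fun i _ => by rw [side_eqF hb k i]

/-- swap a list sum with a finite sum (values in `ZMod 2`). -/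
theorem list_sum_swap' {α β : Type*} (Λ : List α) (s : Finset β) (h : α → β → ZMod 2) :
    (Λ.map fun j => ∑ k ∈ s, h j k).sum = ∑ k ∈ s, (Λ.map fun j => h j k).sum := by
  induction Λ with
  | nil => simp
  | cons a l ih => simp only [List.map_cons, List.sum_cons, ih, Finset.sum_add_distrib]

/-- a list sum of indicators in `ZMod 2` is the cast of the corresponding `countP`. -/
theorem list_sum_ite' {α : Type*} (Λ : List α) (q : α → Bool) :
    (Λ.map fun j => (if q j = true then (1 : ZMod 2) else 0)).sum = ((Λ.countP q : ℕ) : ZMod 2) := by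
  induction Λ with
  | nil => simp
  | cons a l ih =>
    rw [List.map_cons, List.sum_cons, ih, List.countP_cons]
    push_cast
    cases q a <;> simp [add_comm]

/-- **ECHO of `𝔽₂`-degree `≤ d`** at `x` along the placement `b`: the deviation status of every position, as a
function of the flag vector `ε` along the `2^F`-point orbit `x^ε = orbF b ε x`, is an `𝔽₂`-polynomial of degree `≤ d`
(an XOR of monomials `Π_{i∈S} ε_i`, `#S ≤ d`).  Degree 0 = the deviation set is FROZEN along the orbit (the lineage's
DARK inputs); degree 1 = ResponseDial's ADDITIVE response (`echoDeg_one_of_addResp`). -/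
def EchoDeg (d : ℕ) (b : Fin F → ℕ) (P : Fin N → CubeFn (ZMod 3) N) (x : Fin N → Bool) : Prop :=
  ∀ k : Fin N, ∃ M : Finset (Finset (Fin F)), (∀ S ∈ M, S.card ≤ d) ∧
    ∀ ε : Fin F → Bool, k ∈ dev P (orbF b ε x) ↔ (M.filter fun S => ∀ i ∈ S, ε i = true).card % 2 = 1

/-- echo degree `≤ d` implies echo degree `≤ d'` for every `d' ≥ d`. -/
theorem echoDeg_mono {d d' : ℕ} (h : d ≤ d') {b : Fin F → ℕ} {P : Fin N → CubeFn (ZMod 3) N}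
    {x : Fin N → Bool} (hE : EchoDeg d b P x) : EchoDeg d' b P x := fun k => by
  obtain ⟨M, hM, hk⟩ := hE k
  exact ⟨M, fun S hS => le_trans (hM S hS) h, hk⟩

/-- **★ THE ECHO LAW (pointwise)**: given degree-`d` certificates on `F` sites, every strategy whose deviation field
echoes with degree `≤ d` at the odd input `x` loses at one of the `2^F` orbit points.  Proof: in `𝔽₂`, sum the win
identities `Σ_k [k deviates at x^ε ∧ phase admissible at x^ε] = 1` over the certificate `Λ` (odd ⇒ total `1`); swap the
sums; per position the deviation indicator is `Σ_{S ∈ M_k} Π_{i∈S} ε_i`, so the inner count splits into the certificate's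
test columns `(S, grp k, c_k)`, each even ⇒ total `0`. -/
theorem echo_orbit_loses (hN : 3 ≤ N) {b : Fin F → ℕ} (hb : SitesF N F b) {d : ℕ} (hC : CertFamily d F)
    (P : Fin N → CubeFn (ZMod 3) N) (x : Fin N → Bool) (hx : OddZeros x) (hE : EchoDeg d b P x) :
    ∃ ε : Fin F → Bool, ¬ Rel (orbF b ε x) (outB P (orbF b ε x)) := by
  obtain ⟨hbs, hbN⟩ := hb
  set z : Fin F → Bool := fun i => zpar x (b i + 1) with hz
  obtain ⟨Λ, hodd, hcert⟩ := hC z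
  by_contra hall
  push Not at hall
  set c : Fin N → ZMod 3 := fun k => ((cN x k.val : ℕ) : ZMod 3) with hc
  have hW : ∀ ε : Fin F → Bool, (∑ k : Fin N,
      (if k ∈ dev P (orbF b ε x) ∧ c k + phase z ε (grp b k.val) ≠ 2 then (1 : ZMod 2) else 0)) = 1 := by
    intro ε
    have ho : OddZeros (orbF b ε x) := (oddZeros_orbF hbN ε x).2 hx
    have hwin := (win_iff hN P _ ho).1 (hall ε)
    have hphase : ∀ k : Fin N, gCond (orbF b ε x) k.val ↔ c k + phase z ε (grp b k.val) ≠ 2 := by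
      intro k
      rw [gCond_iff_cN, mod3_ne_two, cN_orbF_cast x hbs hbN ε k.val (le_of_lt k.isLt), shift_eqF hbs]
    have hfilt : ((dev P (orbF b ε x)).filter fun k => gCond (orbF b ε x) k.val) =
        univ.filter fun k => k ∈ dev P (orbF b ε x) ∧ c k + phase z ε (grp b k.val) ≠ 2 := by
      ext k
      rw [mem_filter, mem_filter, hphase k]
      simp only [mem_univ, true_and]
    rw [hfilt] at hwin
    have h1 := castZ2_of_mod_eq_one hwin
    rw [natCast_card_filter] at h1
    exact h1
  have hL : (Λ.map fun ε => ∑ k : Fin N,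
      (if k ∈ dev P (orbF b ε x) ∧ c k + phase z ε (grp b k.val) ≠ 2 then (1 : ZMod 2) else 0)).sum =
      (Λ.map fun _ => (1 : ZMod 2)).sum := by
    congr 1
    exact List.map_congr_left fun ε _ => hW ε
  have hR : (Λ.map fun _ => (1 : ZMod 2)).sum = 1 := by
    rw [List.map_const', List.sum_replicate, nsmul_eq_mul, mul_one]
    exact castZ2_of_mod_eq_one hodd
  rw [hR, list_sum_swap'] at hL
  have h0 : ∑ k : Fin N, (Λ.map fun ε =>
      if k ∈ dev P (orbF b ε x) ∧ c k + phase z ε (grp b k.val) ≠ 2 then (1 : ZMod 2) else 0).sum = 0 := by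
    refine sum_eq_zero fun k _ => ?_
    obtain ⟨M, hMd, hM⟩ := hE k
    have hpt : ∀ ε : Fin F → Bool,
        (if k ∈ dev P (orbF b ε x) ∧ c k + phase z ε (grp b k.val) ≠ 2 then (1 : ZMod 2) else 0) =
          ∑ S ∈ M, (if tst z S (grp b k.val) (c k) ε = true then (1 : ZMod 2) else 0) := by
      intro ε
      by_cases hφ : c k + phase z ε (grp b k.val) = 2
      · rw [if_neg (fun h => h.2 hφ)]
        refine (sum_eq_zero fun S _ => if_neg ?_).symm
        unfold tst
        rw [hφ]
        simp
      · have hsum : ∑ S ∈ M, (if tst z S (grp b k.val) (c k) ε = true then (1 : ZMod 2) else 0) =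
            (((M.filter fun S => ∀ i ∈ S, ε i = true).card : ℕ) : ZMod 2) := by
          rw [natCast_card_filter]
          refine sum_congr rfl fun S _ => ?_
          unfold tst monoB
          by_cases hS : ∀ i ∈ S, ε i = true
          · rw [if_pos hS, if_pos (by rw [decide_eq_true hS, decide_eq_true hφ]; rfl)]
          · rw [if_neg hS, if_neg (by simp [hS])]
        rw [hsum]
        rcases Nat.mod_two_eq_zero_or_one (M.filter fun S => ∀ i ∈ S, ε i = true).card with he | he
        · rw [castZ2_of_mod_eq_zero he, if_neg]
          rintro ⟨hk, -⟩
          rw [hM ε] at hk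
          omega
        · rw [castZ2_of_mod_eq_one he, if_pos ⟨(hM ε).2 he, hφ⟩]
    rw [List.map_congr_left (fun ε _ => hpt ε), list_sum_swap']
    refine sum_eq_zero fun S hS => ?_
    rw [list_sum_ite']
    exact castZ2_of_mod_eq_zero (hcert S (hMd S hS) _ _)
  rw [h0] at hL
  exact zero_ne_one hL

/-- `2^F`-fold union bound along the orbit (generic-`F` `ResponseDial.card_exists_orbF_le`). -/
theorem card_exists_orbF_leF (b : Fin F → ℕ) (Q : (Fin N → Bool) → Prop) [DecidablePred Q] :
    (univ.filter fun x : Fin N → Bool => ∃ ε : Fin F → Bool, Q (orbF b ε x)).card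
      ≤ 2 ^ F * (univ.filter fun x => Q x).card := by
  calc (univ.filter fun x : Fin N → Bool => ∃ ε : Fin F → Bool, Q (orbF b ε x)).card
      ≤ (univ.biUnion fun ε : Fin F → Bool => univ.filter fun x : Fin N → Bool => Q (orbF b ε x)).card := by
        refine card_le_card fun x hx => ?_
        rw [mem_filter] at hx
        obtain ⟨ε, hε⟩ := hx.2
        rw [mem_biUnion]
        exact ⟨ε, mem_univ _, mem_filter.2 ⟨mem_univ _, hε⟩⟩
    _ ≤ ∑ ε : Fin F → Bool, (univ.filter fun x : Fin N → Bool => Q (orbF b ε x)).card := card_biUnion_le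
    _ = ∑ ε : Fin F → Bool, (univ.filter fun x => Q x).card := by
        refine sum_congr rfl fun ε _ => ?_
        exact card_filter_orbF Q b ε
    _ = 2 ^ F * (univ.filter fun x => Q x).card := by
        rw [sum_const, card_univ, smul_eq_mul]
        norm_num [Fintype.card_fun, Fintype.card_bool, Fintype.card_fin]

/-- **★ THE ECHO LAW (counting)**: `#{odd x : echo degree ≤ d along b} ≤ 2^F · #{odd losers}` — for EVERY strategy. -/
theorem echo_loss_count (hN : 3 ≤ N) {b : Fin F → ℕ} (hb : SitesF N F b) {d : ℕ} (hC : CertFamily d F)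
    (P : Fin N → CubeFn (ZMod 3) N) :
    (univ.filter fun x : Fin N → Bool => OddZeros x ∧ EchoDeg d b P x).card ≤
      2 ^ F * (univ.filter fun x : Fin N → Bool => OddZeros x ∧ ¬ Rel x (outB P x)).card := by
  refine le_trans (card_le_card fun x hx => ?_)
    (card_exists_orbF_leF b (fun y : Fin N → Bool => OddZeros y ∧ ¬ Rel y (outB P y)))
  rw [mem_filter] at hx ⊢
  obtain ⟨-, hodd, hE⟩ := hx
  obtain ⟨ε, hε⟩ := echo_orbit_loses hN hb hC P x hodd hE
  exact ⟨mem_univ _, ε, (oddZeros_orbF hb.2 ε x).2 hodd, hε⟩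

/-- **THE ECHO LADDER, all rungs**: `#{odd x : echo degree ≤ d along 3(d+1) separated sites} ≤ 8^(d+1) · #{odd losers}`. -/
theorem echo_loss_count_all (hN : 3 ≤ N) (d : ℕ) {b : Fin (3 * (d + 1)) → ℕ} (hb : SitesF N (3 * (d + 1)) b)
    (P : Fin N → CubeFn (ZMod 3) N) :
    (univ.filter fun x : Fin N → Bool => OddZeros x ∧ EchoDeg d b P x).card ≤
      2 ^ (3 * (d + 1)) * (univ.filter fun x : Fin N → Bool => OddZeros x ∧ ¬ Rel x (outB P x)).card :=
  echo_loss_count hN hb (certFamily_all d) P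

end Law

/-! ## §3  RUNGS 0 AND 1 ARE THE LINEAGE'S DARK AND ADDITIVE LAWS (by name) -/

section Rungs
variable {N F : ℕ}

/-- rung 0: a deviation set FROZEN along the orbit (dark inputs) echoes with degree 0. -/
theorem echoDeg_zero_of_frozen {b : Fin F → ℕ} {P : Fin N → CubeFn (ZMod 3) N} {x : Fin N → Bool}
    (h : ∀ ε : Fin F → Bool, dev P (orbF b ε x) = dev P x) : EchoDeg 0 b P x := by
  intro k
  by_cases hk : k ∈ dev P x
  · refine ⟨{∅}, fun S hS => by rw [mem_singleton] at hS; rw [hS, card_empty], fun ε => ?_⟩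
    rw [h ε]
    have : (({∅} : Finset (Finset (Fin F))).filter fun S => ∀ i ∈ S, ε i = true) = {∅} :=
      filter_true_of_mem fun S hS => by rw [mem_singleton] at hS; rw [hS]; simp
    rw [this, card_singleton]
    simpa using hk
  · refine ⟨∅, fun S hS => by simp at hS, fun ε => ?_⟩
    rw [h ε, Finset.filter_empty, card_empty]
    simpa using hk

/-- rung 1: ResponseDial's ADDITIVE response (`AddResp`, five sites) is an echo of degree `≤ 1`
(monomials: `∅` if `k` deviates at `x`, and the singletons `{i}` with `k ∈ R_i`). -/
theorem echoDeg_one_of_addResp {b : Fin 5 → ℕ} {P : Fin N → CubeFn (ZMod 3) N} {R : Fin 5 → Finset (Fin N)}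
    {x : Fin N → Bool} (h : AddResp b P R x) : EchoDeg 1 b P x := by
  intro k
  set M₁ : Finset (Finset (Fin 5)) := (univ.filter fun i : Fin 5 => k ∈ R i).image fun i => ({i} : Finset (Fin 5))
    with hM₁
  set M₀ : Finset (Finset (Fin 5)) := if k ∈ dev P x then {∅} else ∅ with hM₀
  have hdisj : Disjoint M₀ M₁ := by
    rw [hM₀]
    split_ifs
    · rw [disjoint_singleton_left, hM₁, mem_image]
      rintro ⟨i, -, hi⟩
      exact (singleton_ne_empty i) hi
    · exact disjoint_empty_left _
  refine ⟨M₀ ∪ M₁, fun S hS => ?_, fun ε => ?_⟩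
  · rcases mem_union.1 hS with h0 | h1
    · rw [hM₀] at h0
      split_ifs at h0
      · rw [mem_singleton] at h0; rw [h0]; simp
      · simp at h0
    · rw [hM₁, mem_image] at h1
      obtain ⟨i, -, rfl⟩ := h1
      rw [card_singleton]
  rw [filter_union, card_union_of_disjoint (disjoint_filter_filter hdisj)]
  have h1 : (M₁.filter fun S => ∀ i ∈ S, ε i = true).card =
      (univ.filter fun i : Fin 5 => ε i = true ∧ k ∈ R i).card := by
    rw [hM₁, filter_image, card_image_of_injective _ (fun i j (hij : ({i} : Finset (Fin 5)) = {j}) =>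
      singleton_injective hij), filter_filter]
    congr 1
    refine filter_congr fun i _ => ?_
    simp [and_comm]
  rw [h1, h ε]
  by_cases hk : k ∈ dev P x
  · have h0 : (M₀.filter fun S => ∀ i ∈ S, ε i = true).card = 1 := by
      rw [hM₀, if_pos hk]
      have : (({∅} : Finset (Finset (Fin 5))).filter fun S => ∀ i ∈ S, ε i = true) = {∅} :=
        filter_true_of_mem fun S hS => by rw [mem_singleton] at hS; rw [hS]; simp
      rw [this, card_singleton]
    rw [h0]
    constructor
    · intro hh; have := hh.1 hk; omega
    · intro hh; exact ⟨fun _ => by omega, fun _ => hk⟩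
  · have h0 : (M₀.filter fun S => ∀ i ∈ S, ε i = true).card = 0 := by
      rw [hM₀, if_neg hk, Finset.filter_empty, card_empty]
    rw [h0, zero_add]
    constructor
    · intro hh
      by_contra hne
      exact hk (hh.2 (by omega))
    · intro hh; exact ⟨fun hk' => absurd hk' hk, fun h0' => by omega⟩

/-- hence the tree's ADDITIVE-RESPONSE LAW is the rung `(d, F) = (1, 5)` of the echo law (same constant `32 = 2^5`). -/
theorem additive_loss_count' (hN : 3 ≤ N) {b : Fin 5 → ℕ} (hb : ∀ i j : Fin 5, i < j → b i + 2 ≤ b j)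
    (hbN : ∀ i, b i + 3 ≤ N) (P : Fin N → CubeFn (ZMod 3) N) :
    (univ.filter fun x : Fin N → Bool =>
        OddZeros x ∧ ∃ R : Fin 5 → Finset (Fin N), AddResp b P R x).card ≤
      32 * (univ.filter fun x : Fin N → Bool => OddZeros x ∧ ¬ Rel x (outB P x)).card := by
  refine le_trans (card_le_card fun x hx => ?_) (echo_loss_count hN ⟨hb, hbN⟩ certFamily_one_five P)
  rw [mem_filter] at hx ⊢
  obtain ⟨-, hodd, R, hR⟩ := hx
  exact ⟨mem_univ _, hodd, echoDeg_one_of_addResp hR⟩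

/-- and the FROZEN (dark, separated design) law is the rung `(0, 3)`: `#{odd, frozen along 3 sites} ≤ 8·#{odd losers}`. -/
theorem frozen_loss_count (hN : 3 ≤ N) {b : Fin 3 → ℕ} (hb : SitesF N 3 b) (P : Fin N → CubeFn (ZMod 3) N) :
    (univ.filter fun x : Fin N → Bool =>
        OddZeros x ∧ ∀ ε : Fin 3 → Bool, dev P (orbF b ε x) = dev P x).card ≤
      8 * (univ.filter fun x : Fin N → Bool => OddZeros x ∧ ¬ Rel x (outB P x)).card := by
  refine le_trans (card_le_card fun x hx => ?_) (echo_loss_count hN hb certFamily_zero_three P)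
  rw [mem_filter] at hx ⊢
  obtain ⟨-, hodd, hF⟩ := hx
  exact ⟨mem_univ _, hodd, echoDeg_zero_of_frozen hF⟩

end Rungs

end Summit.QuantumAdvantage.QuantumAdvantage.Theorems.EchoDial
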